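import Literature.Analysis.FluidPDE.NSEnergyClassEnergyEquality
import Literature.Analysis.FluidPDE.LerayHopfDatumTorus
import Literature.Analysis.FluidPDE.NSUniqueness2DL4
import HarnessLib

/-!
# Energy-class weak Navier–Stokes solutions are Leray–Hopf: the strong initial trace, the
  packaging, and the two-dimensional theorem (Lions–Prodi)

Analysis/FluidPDE file (theorem-only), conclusion of the chain `NSEnergyClassSlice` →
`NSEnergyClassLevelN` → `NSEnergyClassEnergyEquality`. For a forced weak Navier–Stokes solution
`u` on `T^d × [0, T)` in the energy class (unbundled hypotheses `hw`, `hE`, `hL2`, `hH1`, `hwc`: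
weak formulation, `L^∞L²`, `L²` slices, spectral `L²H¹`, weak `L²`-continuity on `(0,T]` with weak
limit `u₀ ∈ L²` at `0⁺`) with `∫₀ᵀ‖u‖₄⁴ < ∞`, `2 ≤ d ≤ 4`, and a jointly measurable force
`f ∈ L¹(0,T;L²)`:

* `tendsto_integral_norm_sub_sq_nhdsGT`, `tendsto_eLpNorm_sub_nhdsGT` — the **strong initial
  trace** `‖u(t) - u₀‖₂ → 0` as `t → 0⁺` (`‖u(t)‖² → ‖u₀‖²` by the energy equality and
  `u(t) ⇀ u₀`; Temam 1984, Ch. III, Thm. 3.2: `u ∈ C([0,T]; H)`);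
* `isLerayHopfOn_update` — `u` re-defined at the single time `t = 0` by its datum
  (`Function.update u 0 u₀`; no clause of the weak formulation sees the slice `t = 0`, while
  `Torus.IsLerayHopfOn` asks `½‖u(0)‖² ≤ ½‖u₀‖²`) is a Leray–Hopf weak solution on
  `T^d × [0, T)` in the accepted sense, with energy *equalities*;
* **two dimensions** (`d = Fin 2`): `lintegral_lintegral_enorm_pow_four_lt_top_two` —
  `∫₀ᵀ‖u‖₄⁴ < ∞` is automatic (Ladyzhenskaya's inequality slice by slice), whence
  `isLerayHopfOn_update_two` / `isGlobalLerayHopf_update_two`: **on `T²` every forced weak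
  Navier–Stokes solution in the energy class is a Leray–Hopf solution and satisfies the energy
  equality** (Lions–Prodi 1959; Foias–Manley–Rosa–Temam 2001, Ch. II, Thm. 7.3; Temam 1984,
  Ch. III, Thm. 3.2).

## References

* J.-L. Lions, G. Prodi, C. R. Acad. Sci. Paris 248 (1959), 3519–3521.
* R. Temam, *Navier–Stokes Equations*, 3rd ed., North-Holland 1984, Ch. III, Thm. 3.2. [Temam1984]
* C. Foias, O. Manley, R. Rosa, R. Temam, *Navier–Stokes Equations and Turbulence*, CUP 2001,
  Ch. II, Thm. 7.3. [FoiasManleyRosaTemam2001]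
* S. Kuksin, A. Shirikyan, *Mathematics of Two-Dimensional Turbulence*, CUP 2012, Prop. 2.1.9
  (proof). [KuksinShirikyan2012]
-/

noncomputable section

open MeasureTheory TopologicalSpace Set Function Filter Topology UnitAddTorus
open scoped InnerProductSpace RealInnerProductSpace ENNReal NNReal ContDiff

namespace Literature.Analysis.FluidPDE

namespace Torus

namespace WeakNSEnergyClass

variable {d : Type*} [Fintype d] [DecidableEq d]

variable {T ν : ℝ} {f u : ℝ → UnitAddTorus d → EuclideanSpace ℝ d}
  {u₀ : UnitAddTorus d → EuclideanSpace ℝ d}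

/-! ### The strong initial trace -/

omit [DecidableEq d] in
/-- **The dissipation over `(0, t)` vanishes as `t → 0⁺`** when `∫₀ᵀ ‖∇u‖₂² < ∞` (absolute
continuity of the Lebesgue integral). [folklore] -/
theorem tendsto_lintegral_eGradNormSq_nhdsGT (hT : 0 < T)
    (hH1 : FunctionSpaces.Torus.MemL2Sobolev 0 T 1 (fun t => FunctionSpaces.EuclideanSpace.complexify ∘ u t)) :
    Tendsto (fun t => ∫⁻ τ in Ioo 0 t, FunctionSpaces.Torus.eGradNormSq (u τ)) (𝓝[>] 0) (𝓝 0) := by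
  set μT : Measure ℝ := volume.restrict (Ioo 0 T) with hμT
  have hfinT : ∫⁻ τ, FunctionSpaces.Torus.eGradNormSq (u τ) ∂μT ≠ ⊤ :=
    (lintegral_eGradNormSq_lt_top_of_memL2Sobolev hH1).ne
  have hmeas : Tendsto (μT ∘ fun t => Ioo (0 : ℝ) t) (𝓝[>] 0) (𝓝 0) := by
    have h0 : Tendsto (fun t : ℝ => ENNReal.ofReal t) (𝓝[>] 0) (𝓝 0) := by
      have h := (ENNReal.continuous_ofReal.tendsto 0).mono_left (nhdsWithin_le_nhds (s := Ioi (0 : ℝ)))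
      rwa [ENNReal.ofReal_zero] at h
    refine tendsto_of_tendsto_of_tendsto_of_le_of_le tendsto_const_nhds h0 (fun _ => bot_le) fun t => ?_
    show μT (Ioo 0 t) ≤ ENNReal.ofReal t
    calc μT (Ioo 0 t) ≤ volume (Ioo (0 : ℝ) t) := Measure.restrict_apply_le _ _
      _ = ENNReal.ofReal t := by rw [Real.volume_Ioo, sub_zero]
  have h := tendsto_setLIntegral_zero hfinT hmeas
  refine h.congr' ?_
  filter_upwards [Ioo_mem_nhdsGT hT] with t ht
  show ∫⁻ τ in Ioo 0 t, FunctionSpaces.Torus.eGradNormSq (u τ) ∂μT = ∫⁻ τ in Ioo 0 t, FunctionSpaces.Torus.eGradNormSq (u τ)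
  rw [hμT, Measure.restrict_restrict measurableSet_Ioo,
    Set.inter_eq_self_of_subset_left (Ioo_subset_Ioo le_rfl ht.2.le)]

omit [DecidableEq d] in
/-- `∫ ‖a - b‖² = ∫ ‖a‖² - 2 ∫ ⟪a, b⟫ + ∫ ‖b‖²` for `a, b ∈ L²(T^d)`. [folklore] -/
theorem integral_norm_sub_sq_eq {a b : UnitAddTorus d → EuclideanSpace ℝ d} (ha : MemLp a 2 volume)
    (hb : MemLp b 2 volume) :
    ∫ x, ‖a x - b x‖ ^ 2 = (∫ x, ‖a x‖ ^ 2) - 2 * (∫ x, ⟪a x, b x⟫) + ∫ x, ‖b x‖ ^ 2 := by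
  have ia := ha.integrable_norm_pow two_ne_zero
  have ib := hb.integrable_norm_pow two_ne_zero
  have iab := integrable_inner_of_memLp_two ha hb
  have i2 : Integrable (fun x => 2 * ⟪a x, b x⟫) volume := iab.const_mul 2
  have i1 : Integrable (fun x => ‖a x‖ ^ 2 - 2 * ⟪a x, b x⟫) volume := ia.sub i2
  have hpt : ∀ x, ‖a x - b x‖ ^ 2 = ‖a x‖ ^ 2 - 2 * ⟪a x, b x⟫ + ‖b x‖ ^ 2 := fun x => norm_sub_sq_real _ _
  simp_rw [hpt]
  rw [integral_add i1 ib, integral_sub ia i2, integral_const_mul]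

/-- **The strong initial trace of an energy-class weak solution with `∫₀ᵀ‖u‖₄⁴ < ∞`**:
`∫ ‖u(t) - u₀‖² → 0` as `t → 0⁺` — by the energy equality from `0` the energy is right
continuous at `0`, `‖u(t)‖² → ‖u₀‖²`, and `u(t) ⇀ u₀` weakly in `L²`, whence
`‖u(t) - u₀‖² = ‖u(t)‖² - 2⟨u(t), u₀⟩ + ‖u₀‖² → 0` (Temam 1984, Ch. III, Thm. 3.2:
`u ∈ C([0,T]; H)`). [cite: Temam1984, Ch. III §3 Thm. 3.2] -/
theorem tendsto_integral_norm_sub_sq_nhdsGT (hd2 : 2 ≤ Fintype.card d) (hd4 : Fintype.card d ≤ 4) (hT : 0 < T)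
    (hw : IsWeakNSSolutionForcedOn T ν f u₀ u)
    (hE : ∃ C : ℝ≥0, ∀ᵐ t ∂(volume.restrict (Ioo 0 T)), ∫⁻ x, ‖u t x‖ₑ ^ 2 ≤ C)
    (hL2 : ∀ t ∈ Icc 0 T, MemLp (u t) 2 volume)
    (hH1 : FunctionSpaces.Torus.MemL2Sobolev 0 T 1 (fun t => FunctionSpaces.EuclideanSpace.complexify ∘ u t))
    (hwc : ∀ w : UnitAddTorus d → EuclideanSpace ℝ d, MemLp w 2 volume →
      ContinuousOn (fun t => ∫ x, ⟪u t x, w x⟫) (Ioc 0 T) ∧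
        Tendsto (fun t => ∫ x, ⟪u t x, w x⟫) (𝓝[>] 0) (𝓝 (∫ x, ⟪u₀ x, w x⟫)))
    (hu₀ : MemLp u₀ 2 volume) (hL4 : ∫⁻ s in Ioo 0 T, ∫⁻ x, ‖u s x‖ₑ ^ 4 < ⊤)
    (hfm : AEStronglyMeasurable (FunctionSpaces.Torus.stLift f) (volume.restrict (Ioo 0 T ×ˢ univ)))
    (hf : MemLqLp 1 2 f (Ioo 0 T)) :
    Tendsto (fun t => ∫ x, ‖u t x - u₀ x‖ ^ 2) (𝓝[>] 0) (𝓝 0) := by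
  set E₀ : ℝ := ∫ x, ‖u₀ x‖ ^ 2 with hE₀
  -- the work from `0` tends to `0`
  have hW := integrableOn_work_L1L2 hw hE hL2 hfm hf
  have hWlim : Tendsto (fun t => ∫ τ in Ioc 0 t, ∫ x, ⟪f τ x, u τ x⟫) (𝓝[>] 0) (𝓝 0) := by
    have hWi : IntegrableOn (fun τ => ∫ x, ⟪f τ x, u τ x⟫) (Icc 0 T) :=
      (integrableOn_Icc_iff_integrableOn_Ioo (by simp) (by simp)).2 hW
    have hc : ContinuousWithinAt (fun t => ∫ τ in Ioc 0 t, ∫ x, ⟪f τ x, u τ x⟫) (Icc 0 T) 0 :=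
      intervalIntegral.continuousOn_primitive hWi 0 (left_mem_Icc.2 hT.le)
    have h0 : (∫ τ in Ioc (0 : ℝ) 0, ∫ x, ⟪f τ x, u τ x⟫) = 0 := by
      rw [Ioc_self, Measure.restrict_empty, integral_zero_measure]
    rw [ContinuousWithinAt, h0] at hc
    rw [← nhdsWithin_Ioc_eq_nhdsGT hT]
    exact hc.mono_left (nhdsWithin_mono _ Ioc_subset_Icc_self)
  -- the dissipation from `0` tends to `0`
  have hDlim : Tendsto (fun t => (∫⁻ τ in Ioo 0 t, FunctionSpaces.Torus.eGradNormSq (u τ)).toReal) (𝓝[>] 0) (𝓝 0) := by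
    have h := (ENNReal.tendsto_toReal ENNReal.zero_ne_top).comp (tendsto_lintegral_eGradNormSq_nhdsGT hT hH1)
    rwa [ENNReal.toReal_zero] at h
  -- the energy tends to the datum energy
  have hElim : Tendsto (fun t => ∫ x, ‖u t x‖ ^ 2) (𝓝[>] 0) (𝓝 E₀) := by
    have hlim : Tendsto (fun t => E₀ + 2 * ((∫ τ in Ioc 0 t, ∫ x, ⟪f τ x, u τ x⟫) -
        ν * (∫⁻ τ in Ioo 0 t, FunctionSpaces.Torus.eGradNormSq (u τ)).toReal)) (𝓝[>] 0) (𝓝 (E₀ + 2 * (0 - ν * 0))) :=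
      tendsto_const_nhds.add ((hWlim.sub (hDlim.const_mul ν)).const_mul 2)
    rw [mul_zero, sub_zero, mul_zero, add_zero] at hlim
    refine hlim.congr' ?_
    filter_upwards [Ioo_mem_nhdsGT hT] with t ht
    have h := energy_eq_zero hd2 hd4 hw hE hL2 hH1 hwc hu₀ hL4 hfm hf t ⟨ht.1, ht.2.le⟩
    rw [intervalIntegral.integral_of_le ht.1.le] at h
    simp only [FunctionSpaces.Torus.kineticEnergy] at h
    rw [hE₀]
    linarith
  -- the cross term tends to the datum energy (weak convergence)
  have hXlim : Tendsto (fun t => ∫ x, ⟪u t x, u₀ x⟫) (𝓝[>] 0) (𝓝 E₀) := by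
    have h := (hwc u₀ hu₀).2
    have heq : (∫ x, ⟪u₀ x, u₀ x⟫) = E₀ := by
      rw [hE₀]
      exact integral_congr_ae (ae_of_all _ fun x => real_inner_self_eq_norm_sq _)
    rwa [heq] at h
  -- expand the square
  have hlim : Tendsto (fun t => (∫ x, ‖u t x‖ ^ 2) - 2 * (∫ x, ⟪u t x, u₀ x⟫) + E₀) (𝓝[>] 0) (𝓝 (E₀ - 2 * E₀ + E₀)) :=
    (hElim.sub (hXlim.const_mul 2)).add tendsto_const_nhds
  rw [show E₀ - 2 * E₀ + E₀ = 0 by ring] at hlim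
  refine hlim.congr' ?_
  filter_upwards [Ioo_mem_nhdsGT hT] with t ht
  exact (integral_norm_sub_sq_eq (hL2 t (Ioo_subset_Icc_self ht)) hu₀).symm

/-- **The strong initial trace in `L²`**: `eLpNorm (u t - u₀) 2 → 0` as `t → 0⁺`, under the
hypotheses of `tendsto_integral_norm_sub_sq_nhdsGT`. [cite: Temam1984, Ch. III §3 Thm. 3.2] -/
theorem tendsto_eLpNorm_sub_nhdsGT (hd2 : 2 ≤ Fintype.card d) (hd4 : Fintype.card d ≤ 4) (hT : 0 < T)
    (hw : IsWeakNSSolutionForcedOn T ν f u₀ u)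
    (hE : ∃ C : ℝ≥0, ∀ᵐ t ∂(volume.restrict (Ioo 0 T)), ∫⁻ x, ‖u t x‖ₑ ^ 2 ≤ C)
    (hL2 : ∀ t ∈ Icc 0 T, MemLp (u t) 2 volume)
    (hH1 : FunctionSpaces.Torus.MemL2Sobolev 0 T 1 (fun t => FunctionSpaces.EuclideanSpace.complexify ∘ u t))
    (hwc : ∀ w : UnitAddTorus d → EuclideanSpace ℝ d, MemLp w 2 volume →
      ContinuousOn (fun t => ∫ x, ⟪u t x, w x⟫) (Ioc 0 T) ∧
        Tendsto (fun t => ∫ x, ⟪u t x, w x⟫) (𝓝[>] 0) (𝓝 (∫ x, ⟪u₀ x, w x⟫)))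
    (hu₀ : MemLp u₀ 2 volume) (hL4 : ∫⁻ s in Ioo 0 T, ∫⁻ x, ‖u s x‖ₑ ^ 4 < ⊤)
    (hfm : AEStronglyMeasurable (FunctionSpaces.Torus.stLift f) (volume.restrict (Ioo 0 T ×ˢ univ)))
    (hf : MemLqLp 1 2 f (Ioo 0 T)) :
    Tendsto (fun t => eLpNorm (u t - u₀) 2 volume) (𝓝[>] 0) (𝓝 0) := by
  have h := tendsto_integral_norm_sub_sq_nhdsGT hd2 hd4 hT hw hE hL2 hH1 hwc hu₀ hL4 hfm hf
  -- `eLpNorm g 2 = (ofReal ∫‖g‖²)^{1/2}` for `g ∈ L²`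
  have h1 : Tendsto (fun t => (ENNReal.ofReal (∫ x, ‖u t x - u₀ x‖ ^ 2)) ^ (1 / 2 : ℝ)) (𝓝[>] 0) (𝓝 0) := by
    have ho : Tendsto (fun t => ENNReal.ofReal (∫ x, ‖u t x - u₀ x‖ ^ 2)) (𝓝[>] 0) (𝓝 0) := by
      have := (ENNReal.continuous_ofReal.tendsto 0).comp h
      rwa [ENNReal.ofReal_zero] at this
    have hc := (ENNReal.continuous_rpow_const (y := (1 / 2 : ℝ))).tendsto 0
    rw [ENNReal.zero_rpow_of_pos (by norm_num)] at hc
    exact hc.comp ho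
  refine h1.congr' ?_
  filter_upwards [Ioo_mem_nhdsGT hT] with t ht
  have hmem : MemLp (u t - u₀) 2 volume := (hL2 t (Ioo_subset_Icc_self ht)).sub hu₀
  rw [eLpNorm_eq_lintegral_rpow_enorm_toReal two_ne_zero ENNReal.ofNat_ne_top, ENNReal.toReal_ofNat]
  simp only [ENNReal.rpow_two]
  rw [Torus.lintegral_enorm_sq_eq_ofReal hmem]
  rfl

/-! ### The packaging as a Leray–Hopf solution -/

/-- **An energy-class weak solution with `∫₀ᵀ‖u‖₄⁴ < ∞` is Leray–Hopf** (after re-defining the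
free slice `t = 0` by the datum): under the hypotheses of `energy_eq_zero` with `T > 0`,
`Function.update u 0 u₀` satisfies every clause of `Torus.IsLerayHopfOn T ν f u₀` — the weak
formulation, the bounds and the weak continuity do not see `t = 0`; the energy inequalities hold
with equality (`energy_eq_zero`, `energy_eq_of_mem_Ioc`); the strong initial trace is
`tendsto_eLpNorm_sub_nhdsGT` (Lions 1960 / Shinbrot 1974; Temam 1984, Ch. III, Thm. 3.2). [cite: Temam1984, Ch. III §3 Thm. 3.2] -/
theorem isLerayHopfOn_update (hd2 : 2 ≤ Fintype.card d) (hd4 : Fintype.card d ≤ 4) (hT : 0 < T)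
    (hw : IsWeakNSSolutionForcedOn T ν f u₀ u)
    (hE : ∃ C : ℝ≥0, ∀ᵐ t ∂(volume.restrict (Ioo 0 T)), ∫⁻ x, ‖u t x‖ₑ ^ 2 ≤ C)
    (hL2 : ∀ t ∈ Icc 0 T, MemLp (u t) 2 volume)
    (hH1 : FunctionSpaces.Torus.MemL2Sobolev 0 T 1 (fun t => FunctionSpaces.EuclideanSpace.complexify ∘ u t))
    (hwc : ∀ w : UnitAddTorus d → EuclideanSpace ℝ d, MemLp w 2 volume →
      ContinuousOn (fun t => ∫ x, ⟪u t x, w x⟫) (Ioc 0 T) ∧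
        Tendsto (fun t => ∫ x, ⟪u t x, w x⟫) (𝓝[>] 0) (𝓝 (∫ x, ⟪u₀ x, w x⟫)))
    (hu₀ : MemLp u₀ 2 volume) (hL4 : ∫⁻ s in Ioo 0 T, ∫⁻ x, ‖u s x‖ₑ ^ 4 < ⊤)
    (hfm : AEStronglyMeasurable (FunctionSpaces.Torus.stLift f) (volume.restrict (Ioo 0 T ×ˢ univ)))
    (hf : MemLqLp 1 2 f (Ioo 0 T)) :
    IsLerayHopfOn T ν f u₀ (Function.update u 0 u₀) := by
  set v : ℝ → UnitAddTorus d → EuclideanSpace ℝ d := Function.update u 0 u₀ with hv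
  have hv0 : v 0 = u₀ := Function.update_self 0 u₀ u
  have hvt : ∀ t : ℝ, t ≠ 0 → v t = u t := fun t ht => Function.update_of_ne ht u₀ u
  have hvIoo : ∀ t ∈ Ioo 0 T, v t = u t := fun t ht => hvt t ht.1.ne'
  have hvIoc : ∀ t ∈ Ioc 0 T, v t = u t := fun t ht => hvt t ht.1.ne'
  -- dissipation and work of `v` on intervals inside `(0, T]`
  have hD : ∀ {s t : ℝ}, 0 ≤ s → t ≤ T →
      ∫⁻ τ in Ioo s t, FunctionSpaces.Torus.eGradNormSq (v τ) = ∫⁻ τ in Ioo s t, FunctionSpaces.Torus.eGradNormSq (u τ) :=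
    fun hs ht => setLIntegral_congr_fun measurableSet_Ioo fun τ hτ => by rw [hvIoo τ ⟨hs.trans_lt hτ.1, hτ.2.trans_le ht⟩]
  have hWv : ∀ {s t : ℝ}, 0 ≤ s → s ≤ t → t ≤ T →
      ∫ τ in s..t, ∫ x, ⟪f τ x, v τ x⟫ = ∫ τ in s..t, ∫ x, ⟪f τ x, u τ x⟫ := by
    intro s t hs hst ht
    rw [intervalIntegral.integral_of_le hst, intervalIntegral.integral_of_le hst]
    exact setIntegral_congr_fun measurableSet_Ioc fun τ hτ => by simp only [hvIoc τ ⟨hs.trans_lt hτ.1, hτ.2.trans ht⟩]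
  exact
  { weak := hw.congr_of_eqOn_Ioo hvIoo
    energy_bound := by
      obtain ⟨C, hC⟩ := hE
      refine ⟨C, ?_⟩
      filter_upwards [hC, ae_restrict_mem measurableSet_Ioo] with t ht htI
      rw [hvIoo t htI]
      exact ht
    memLp := fun t ht => by
      rcases eq_or_ne t 0 with rfl | h0
      · rw [hv0]; exact hu₀
      · rw [hvt t h0]; exact hL2 t ht
    memL2Sobolev := by
      refine ⟨?_, ?_⟩
      · filter_upwards [hH1.1, ae_restrict_mem measurableSet_Ioo] with t ht htI
        show FunctionSpaces.Torus.MemSobolev 1 (FunctionSpaces.EuclideanSpace.complexify ∘ v t)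
        rw [hvIoo t htI]
        exact ht
      · have heq : (∫⁻ t in Ioo 0 T, FunctionSpaces.Torus.eSobolevNorm 1 (FunctionSpaces.EuclideanSpace.complexify ∘ v t) ^ 2) =
            ∫⁻ t in Ioo 0 T, FunctionSpaces.Torus.eSobolevNorm 1 (FunctionSpaces.EuclideanSpace.complexify ∘ u t) ^ 2 :=
          setLIntegral_congr_fun measurableSet_Ioo fun t ht => by simp only [hvIoo t ht]
        show (∫⁻ t in Ioo 0 T, FunctionSpaces.Torus.eSobolevNorm 1 (FunctionSpaces.EuclideanSpace.complexify ∘ v t) ^ 2) ^ (1 / 2 : ℝ) < ⊤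
        rw [heq]
        exact hH1.2
    energy_ineq_zero := fun t ht => by
      rcases eq_or_lt_of_le ht.1 with h0 | htpos
      · subst h0
        rw [hv0, Ioo_self, Measure.restrict_empty, lintegral_zero_measure, ENNReal.toReal_zero, mul_zero,
          intervalIntegral.integral_same]
      · have httT : t ∈ Ioc 0 T := ⟨htpos, ht.2⟩
        have h := energy_eq_zero hd2 hd4 hw hE hL2 hH1 hwc hu₀ hL4 hfm hf t httT
        rw [hvIoc t httT, hD le_rfl ht.2, hWv le_rfl ht.1 ht.2]
        exact h.le
    energy_ineq_ae := by
      filter_upwards [ae_restrict_mem measurableSet_Ioo] with s hs t ht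
      have hsT : s ∈ Ioc 0 T := ⟨hs.1, hs.2.le⟩
      have h := energy_eq_of_mem_Ioc hd2 hd4 hw hE hL2 hH1 hwc hu₀ hL4 hfm hf hsT ht
      rw [hvIoc s hsT, hvIoc t ⟨hs.1.trans_le ht.1, ht.2⟩, hD hs.1.le ht.2, hWv hs.1.le ht.1 ht.2]
      exact h.le
    weak_continuous := fun w hw' => by
      obtain ⟨hc, hl⟩ := hwc w hw'
      refine ⟨hc.congr fun t ht => ?_, hl.congr' ?_⟩
      · simp only [hvIoc t ht]
      · filter_upwards [Ioo_mem_nhdsGT hT] with t ht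
        simp only [hvIoo t ht]
    strong_initial := by
      refine (tendsto_eLpNorm_sub_nhdsGT hd2 hd4 hT hw hE hL2 hH1 hwc hu₀ hL4 hfm hf).congr' ?_
      filter_upwards [Ioo_mem_nhdsGT hT] with t ht
      rw [hvIoo t ht] }

/-! ### Two dimensions: Lions–Prodi -/

section TwoD

variable {g v : ℝ → UnitAddTorus (Fin 2) → EuclideanSpace ℝ (Fin 2)}
  {v₀ : UnitAddTorus (Fin 2) → EuclideanSpace ℝ (Fin 2)}

/-- **`∫₀ᵀ ‖v(s)‖₄⁴ ds < ∞` in the energy class on `T²`** (Ladyzhenskaya's inequality slice by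
slice, `‖v(s)‖₄⁴ ≤ C |v(s)|² (|v(s)|² + ‖∇v(s)‖²)`, with `|v(s)|²` bounded a.e. and
`∫₀ᵀ‖∇v‖² < ∞`; Kuksin–Shirikyan 2012, proof of Prop. 2.1.9; energy-class twin of
`Torus.IsLerayHopfOn.lintegral_lintegral_enorm_pow_four_lt_top`). [cite: KuksinShirikyan2012, Prop. 2.1.9 (proof)] -/
theorem lintegral_lintegral_enorm_pow_four_lt_top_two
    (hE : ∃ C : ℝ≥0, ∀ᵐ t ∂(volume.restrict (Ioo 0 T)), ∫⁻ x, ‖v t x‖ₑ ^ 2 ≤ C)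
    (hL2 : ∀ t ∈ Icc 0 T, MemLp (v t) 2 volume)
    (hH1 : FunctionSpaces.Torus.MemL2Sobolev 0 T 1 (fun t => FunctionSpaces.EuclideanSpace.complexify ∘ v t)) :
    ∫⁻ s in Ioo 0 T, ∫⁻ x, ‖v s x‖ₑ ^ 4 < ⊤ := by
  obtain ⟨C, hC, hLad⟩ := exists_ladyzhenskaya_const_memLp
  obtain ⟨M, hM⟩ := hE
  have hpt : ∀ᵐ s ∂(volume.restrict (Ioo 0 T)), ∫⁻ x, ‖v s x‖ₑ ^ 4 ≤
      C * ((M : ℝ≥0∞) * ((M : ℝ≥0∞) + FunctionSpaces.Torus.eGradNormSq (v s))) := by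
    filter_upwards [hM, ae_restrict_mem measurableSet_Ioo] with s hs hsI
    exact (hLad (v s) (hL2 s (Ioo_subset_Icc_self hsI))).trans (by gcongr)
  calc ∫⁻ s in Ioo 0 T, ∫⁻ x, ‖v s x‖ₑ ^ 4
      ≤ ∫⁻ s in Ioo 0 T, C * ((M : ℝ≥0∞) * ((M : ℝ≥0∞) + FunctionSpaces.Torus.eGradNormSq (v s))) := lintegral_mono_ae hpt
    _ = C * ((M : ℝ≥0∞) * ((∫⁻ _ in Ioo 0 T, (M : ℝ≥0∞)) + ∫⁻ s in Ioo 0 T, FunctionSpaces.Torus.eGradNormSq (v s))) := by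
        rw [lintegral_const_mul' _ _ hC, lintegral_const_mul' _ _ ENNReal.coe_ne_top, lintegral_add_left' aemeasurable_const]
    _ < ⊤ := by
        rw [setLIntegral_const]
        exact ENNReal.mul_lt_top hC.lt_top (ENNReal.mul_lt_top ENNReal.coe_lt_top (ENNReal.add_lt_top.2
          ⟨ENNReal.mul_lt_top ENNReal.coe_lt_top measure_Ioo_lt_top, lintegral_eGradNormSq_lt_top_of_memL2Sobolev hH1⟩))

/-- **Lions–Prodi: on `T²` every forced weak Navier–Stokes solution in the energy class is a
Leray–Hopf solution** (after re-defining the free slice `t = 0` by the datum). Let `v` be a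
forced weak solution on `T² × [0, T)`, `T > 0` (`Torus.IsWeakNSSolutionForcedOn T ν g v₀ v`) in
`L^∞(0,T;L²)` with `L²` slices on `[0,T]`, in `L²(0,T;H¹)` spectrally, weakly `L²`-continuous
on `(0, T]` with weak limit `v₀ ∈ L²` at `0⁺`, with a jointly measurable force
`g ∈ L¹(0,T;L²)`. Then `Function.update v 0 v₀` is a Leray–Hopf weak solution on `[0, T)`
(with energy equalities and a strong initial trace): `∫₀ᵀ‖v‖₄⁴ < ∞` by Ladyzhenskaya's
inequality, and `isLerayHopfOn_update` applies (Lions–Prodi 1959; Foias–Manley–Rosa–Temam 2001,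
Ch. II, Thm. 7.3; Temam 1984, Ch. III, Thm. 3.2). [cite: FoiasManleyRosaTemam2001, Ch. II Thm. 7.3] -/
theorem isLerayHopfOn_update_two (hT : 0 < T)
    (hw : IsWeakNSSolutionForcedOn T ν g v₀ v)
    (hE : ∃ C : ℝ≥0, ∀ᵐ t ∂(volume.restrict (Ioo 0 T)), ∫⁻ x, ‖v t x‖ₑ ^ 2 ≤ C)
    (hL2 : ∀ t ∈ Icc 0 T, MemLp (v t) 2 volume)
    (hH1 : FunctionSpaces.Torus.MemL2Sobolev 0 T 1 (fun t => FunctionSpaces.EuclideanSpace.complexify ∘ v t))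
    (hwc : ∀ w : UnitAddTorus (Fin 2) → EuclideanSpace ℝ (Fin 2), MemLp w 2 volume →
      ContinuousOn (fun t => ∫ x, ⟪v t x, w x⟫) (Ioc 0 T) ∧
        Tendsto (fun t => ∫ x, ⟪v t x, w x⟫) (𝓝[>] 0) (𝓝 (∫ x, ⟪v₀ x, w x⟫)))
    (hv₀ : MemLp v₀ 2 volume)
    (hgm : AEStronglyMeasurable (FunctionSpaces.Torus.stLift g) (volume.restrict (Ioo 0 T ×ˢ univ)))
    (hg : MemLqLp 1 2 g (Ioo 0 T)) :
    IsLerayHopfOn T ν g v₀ (Function.update v 0 v₀) :=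
  isLerayHopfOn_update (by simp) (by simp) hT hw hE hL2 hH1 hwc hv₀
    (lintegral_lintegral_enorm_pow_four_lt_top_two hE hL2 hH1) hgm hg

/-- **Global form**: on `T² × [0, ∞)`, a field which on every `[0, T)`, `T > 0`, is a forced weak
Navier–Stokes solution in the energy class, weakly `L²`-continuous with weak limit `v₀ ∈ L²` at
`0⁺`, under a jointly measurable force in `L¹(0,T;L²)` for every `T`, is — re-defined at
`t = 0` by `v₀` — a global Leray–Hopf solution (`Torus.IsGlobalLerayHopf`). [cite: FoiasManleyRosaTemam2001, Ch. II Thm. 7.3] -/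
theorem isGlobalLerayHopf_update_two
    (hw : ∀ T, 0 < T → IsWeakNSSolutionForcedOn T ν g v₀ v)
    (hE : ∀ T, 0 < T → ∃ C : ℝ≥0, ∀ᵐ t ∂(volume.restrict (Ioo 0 T)), ∫⁻ x, ‖v t x‖ₑ ^ 2 ≤ C)
    (hL2 : ∀ t, 0 ≤ t → MemLp (v t) 2 volume)
    (hH1 : ∀ T, 0 < T → FunctionSpaces.Torus.MemL2Sobolev 0 T 1 (fun t => FunctionSpaces.EuclideanSpace.complexify ∘ v t))
    (hwc : ∀ T, 0 < T → ∀ w : UnitAddTorus (Fin 2) → EuclideanSpace ℝ (Fin 2), MemLp w 2 volume →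
      ContinuousOn (fun t => ∫ x, ⟪v t x, w x⟫) (Ioc 0 T) ∧
        Tendsto (fun t => ∫ x, ⟪v t x, w x⟫) (𝓝[>] 0) (𝓝 (∫ x, ⟪v₀ x, w x⟫)))
    (hv₀ : MemLp v₀ 2 volume)
    (hgm : ∀ T, 0 < T → AEStronglyMeasurable (FunctionSpaces.Torus.stLift g) (volume.restrict (Ioo 0 T ×ˢ univ)))
    (hg : ∀ T, 0 < T → MemLqLp 1 2 g (Ioo 0 T)) :
    IsGlobalLerayHopf ν g v₀ (Function.update v 0 v₀) := fun T hT =>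
  isLerayHopfOn_update_two hT (hw T hT) (hE T hT) (fun t ht => hL2 t ht.1) (hH1 T hT) (hwc T hT) hv₀ (hgm T hT) (hg T hT)

end TwoD

end WeakNSEnergyClass

end Torus

end Literature.Analysis.FluidPDE

end
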